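import Literature.MathematicalPhysics.QuantumFieldTheory.Balaban1983to89.B15BasicStep

/-!
# N21 (NE7c) — module 38e «BRANCH-REFINED INSERTS» (LENS nearmiss v22.0 ROW P″ (c), Cards 63∕64; Sketch-g22 §B): print's (1.88) branch factor RIDES ON
# THE SENT TERM — it reads neither the fibre nor the older coordinates, so it commutes with the hybrid lift, and 38b∕38c's three displayed (Eon)
# binders (`hquot` against the insert, the support proviso, the nesting `hdom`) need hold ONLY ON THE BRANCH `{φ ≠ 0}`, where BOTH inserts work

PROVENANCE AND CREDIT.  This module is the planner seat `ym-lens-BalabanUVNodes-nearmiss`'s `Sketch-nearmiss-g22.lean` §B (typed companion of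
`LENS-nearmiss.md` v22.0 sha16 36c115a6596dd92d, Cards 63∕64, FAN-OUT ROW P″ (c) «optional first refusal: land §B (6 lemmas) verbatim as rider
`…N21BranchRefinedInserts`», bus l.22005; sketch sha16 acefbfe6352570d4, md5-16 b5190989fd24127c, farm rc 0) landed VERBATIM by seat
`pub-ymgap-dag-n21-e` (g12); only this header and the namespace are the filer's; authorship of the mathematics: the lens.  Lane: `--kind proof
--supports stmt-QuantumFields-20544 --as helper` (K3⁷ `SpineGivenEndpointR13SepCoPH`).  Count-neutral.  Consumers: the record INSTANCE of 38c
`…N21HistoriesHybridLiftTower.shellWeightBound_histories_of_liftedDensities` (t23 pen): its `hquot`∕`hden`∕`hdom` on the (1.88)-REFINED sent family.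

THE LENS'S WHY (v22.0 Card 63, abridged).  [IV] (1.88) p. 197 re-decomposes the EXTERIOR boundary layer of a sent component at HALF threshold; that
decomposition of unity is a factor `φ` reading neither the fibre `F` nor the older coordinates `O` (`IndepOf (O ∪ F) φ`), so it COMMUTES with both
marginals of 38a's `hybridLift` ∕ 38b's `liftDensity … ins d s` and may be booked on the SENT density: `d s = φ·d s + (1−φ)·d s` (`branch_split`); the
three displayed binders of 38b∕38c — `hquot` against the insert, the support proviso, `hdom` — then need hold ONLY ON THE BRANCH `{φ ≠ 0}`
(`hq_of_branch`, `proviso_of_branch`, `hdom_of_branch`); the `(1−φ)`-pieces (P ≠ ∅, BIRTHS) are not sent and keep the sender's law exactly.  Card 64: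
ON THE BRANCH THE RECEIVER INSERT SUFFICES — `q_receiver ≤ q_window · B` by nesting (`hq_receiver_of_window`), so 38b's generic insert may be
instantiated `ins s := φ_s · d (sel s)` with `B = 1`, the window living only INSIDE the proof of `hquot`.  (On the UNREFINED sent family neither insert
works on sharp-threshold terms — lens Cards 61∕63, Sketch-g21 §T ∕ Sketch-g22 §W caricatures, not landed.)

HONEST FRAMING.  [textbook]∕[folklore] measure theory on finite products (Mathlib `lmarginal`, b01 `IndepOf`); 0 def, 0 sorry; NOTHING of Bałaban's is
asserted ((1.88)∕(1.89) pp. 197–198 of [Balaban1989LargeFieldI] and (1.3)–(1.11) pp. 358–359 of [LF-II] are CONTEXT); the quotient `q`, the nesting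
`B` and the branch factor of record are DISPLAYED, never estimated (NODE O ∕ t23 pen); NE7c ((M1) at the live slots) is NOT PRINTED and NOT PROVED;
N21 NOT discharged; count-neutral; one finite 𝕋⁴ at fixed ε — nothing about ℝ⁴ ∕ OS ∕ mass gap ∕ Clay.

CITATION HEADER (lean-in-tree rule).  BY NAME: b01 `B15.BasicStep.IndepOf` ∕ `lmarginal_mul_of_indepOf`; Mathlib `lmarginal`, `measurable_updateFinset`,
`lintegral_const_mul`.  Context: 38a `N21HybridResamplingLift.map_hybridLift_le_of_notReadOlder`, 38b `N21HistoriesLiftedStageLaws.map_postLaw_le_of_sent`.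
-/

set_option autoImplicit false

open MeasureTheory Set Function
open scoped ENNReal NNReal

namespace Summit.QuantumFields.YangMills.Theorems.N21BranchRefinedInserts

/-! ## §B  Card 63 — the branch factor rides on the sent term (hooks over 38a's currency) -/

section Branch

variable {ι : Type*} [DecidableEq ι] {X : ι → Type*} [∀ i, MeasurableSpace (X i)] (μ : ∀ i, Measure (X i))

open Literature.MathematicalPhysics.QuantumFieldTheory.Balaban1983to89.B15.BasicStep

omit [∀ i, MeasurableSpace (X i)] in
/-- the complementary branch factor does not read `s` either. [textbook] -/
theorem indepOf_one_sub (s : Finset ι) {φ : (∀ i, X i) → ℝ≥0∞} (hφ : IndepOf s φ) :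
    IndepOf s (fun V => 1 - φ V) := by
  intro x y
  show 1 - φ (updateFinset x s y) = 1 - φ x
  rw [hφ x y]

omit [DecidableEq ι] [∀ i, MeasurableSpace (X i)] in
/-- **MASS SPLIT**: a decomposition of unity `φ + (1 − φ) = 1` (`φ ≤ 1`) splits the sender's density into the SENT piece
`φ·a` and the BORN piece `(1−φ)·a`. [textbook] -/
theorem branch_split {φ a : (∀ i, X i) → ℝ≥0∞} (hφ1 : ∀ V, φ V ≤ 1) :
    φ * a + (fun V => 1 - φ V) * a = a := by
  ext V
  simp only [Pi.add_apply, Pi.mul_apply]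
  rw [← add_mul, add_tsub_cancel_of_le (hφ1 V), one_mul]

variable {μ} in
/-- **(B1) `hquot` ON THE BRANCH SUFFICES**: a factor `φ` not reading the integrated coordinates `s` (`= O ∪ F` for 38a's
`map_hybridLift_le_of_notReadOlder`, `= F` for the fibre forms) passes through the marginal, so the quotient bound for the
branch-refined pair `(φ·a, φ·w)` holds for EVERY exterior as soon as it holds where `φ ≠ 0`. [folklore] -/
theorem hq_of_branch (s : Finset ι) {φ a w : (∀ i, X i) → ℝ≥0∞} (hφ : IndepOf s φ)
    (ha : Measurable a) (hw : Measurable w) {q : ℝ≥0∞}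
    (hq : ∀ V, φ V ≠ 0 → (∫⋯∫⁻_s, a ∂μ) V ≤ q * (∫⋯∫⁻_s, w ∂μ) V) :
    ∀ V, (∫⋯∫⁻_s, φ * a ∂μ) V ≤ q * (∫⋯∫⁻_s, φ * w ∂μ) V := by
  intro V
  rw [lmarginal_mul_of_indepOf s hφ ha, lmarginal_mul_of_indepOf s hφ hw]
  simp only [Pi.mul_apply]
  by_cases h : φ V = 0
  · simp [h]
  · calc φ V * (∫⋯∫⁻_s, a ∂μ) V ≤ φ V * (q * (∫⋯∫⁻_s, w ∂μ) V) := by gcongr; exact hq V h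
      _ = q * (φ V * (∫⋯∫⁻_s, w ∂μ) V) := by ring

variable {μ} in
/-- **(B2) THE SUPPORT PROVISO ON THE BRANCH**: if the insert's own fibre integral never vanishes (a window ∕ the fat
receiver fibre on the branch), then for the branch-refined pair «insert's fibre integral `= 0` ⇒ sender's `= 0`» — 38b's
proviso for `(L1)∕(L4)∕(L5)`. [folklore] -/
theorem proviso_of_branch (s : Finset ι) {φ a w : (∀ i, X i) → ℝ≥0∞} (hφ : IndepOf s φ)
    (ha : Measurable a) (hw : Measurable w) (hw0 : ∀ V, φ V ≠ 0 → (∫⋯∫⁻_s, w ∂μ) V ≠ 0) :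
    ∀ V, (∫⋯∫⁻_s, φ * w ∂μ) V = 0 → (∫⋯∫⁻_s, φ * a ∂μ) V = 0 := by
  intro V hV
  rw [lmarginal_mul_of_indepOf s hφ hw, Pi.mul_apply, mul_eq_zero] at hV
  rw [lmarginal_mul_of_indepOf s hφ ha, Pi.mul_apply]
  rcases hV with h | h
  · simp [h]
  · by_cases hφV : φ V = 0
    · simp [hφV]
    · exact absurd h (hw0 V hφV)

omit [DecidableEq ι] [∀ i, MeasurableSpace (X i)] in
/-- **(B3) `hdom` ON THE BRANCH SUFFICES**: with `φ ≤ 1`, the pointwise nesting `ins ≤ B·receiver` for the branch-refined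
insert `φ·w` follows from nesting where `φ ≠ 0` ((1.89) on the small branch). [folklore] -/
theorem hdom_of_branch {φ w r : (∀ i, X i) → ℝ≥0∞} {B : ℝ≥0∞} (hφ1 : ∀ V, φ V ≤ 1)
    (hdom : ∀ V, φ V ≠ 0 → w V ≤ B * r V) : ∀ V, (φ * w) V ≤ B * r V := by
  intro V
  simp only [Pi.mul_apply]
  by_cases h : φ V = 0
  · simp [h]
  · calc φ V * w V ≤ 1 * (B * r V) := mul_le_mul' (hφ1 V) (hdom V h)
      _ = B * r V := one_mul _

variable {μ} in
/-- **(B4) = Card 64's general form — THE RECEIVER'S QUOTIENT IS AT MOST THE WINDOW'S TIMES THE NESTING CONSTANT**: on the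
branch, `∫_s a ≤ q·∫_s w` (print's window estimate, [LF-II] (1.3)–(1.11)) and `w ≤ B·r` (nesting (1.89)) give
`∫_s a ≤ q·B·∫_s r` — the receiver insert `φ·r` instantiates 38b's `ins` with `hdom` trivial, the window `w` living only
inside this proof. [folklore] -/
theorem hq_receiver_of_window (s : Finset ι) {φ a w r : (∀ i, X i) → ℝ≥0∞} {q B : ℝ≥0∞} (hφ : IndepOf s φ)
    (hr : Measurable r)
    (hdom : ∀ V, φ V ≠ 0 → w V ≤ B * r V)
    (hq : ∀ V, φ V ≠ 0 → (∫⋯∫⁻_s, a ∂μ) V ≤ q * (∫⋯∫⁻_s, w ∂μ) V) :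
    ∀ V, φ V ≠ 0 → (∫⋯∫⁻_s, a ∂μ) V ≤ q * B * (∫⋯∫⁻_s, r ∂μ) V := by
  intro V hV
  have hwr : (∫⋯∫⁻_s, w ∂μ) V ≤ B * (∫⋯∫⁻_s, r ∂μ) V := by
    simp only [lmarginal]
    calc ∫⁻ y, w (updateFinset V s y) ∂Measure.pi (fun i : s => μ i)
        ≤ ∫⁻ y, B * r (updateFinset V s y) ∂Measure.pi (fun i : s => μ i) :=
          lintegral_mono fun y => hdom _ (by rw [hφ V y]; exact hV)
      _ = B * ∫⁻ y, r (updateFinset V s y) ∂Measure.pi (fun i : s => μ i) :=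
          lintegral_const_mul B (hr.comp measurable_updateFinset)
  calc (∫⋯∫⁻_s, a ∂μ) V ≤ q * (∫⋯∫⁻_s, w ∂μ) V := hq V hV
    _ ≤ q * (B * (∫⋯∫⁻_s, r ∂μ) V) := by gcongr
    _ = q * B * (∫⋯∫⁻_s, r ∂μ) V := (mul_assoc _ _ _).symm

end Branch

end Summit.QuantumFields.YangMills.Theorems.N21BranchRefinedInserts
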